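import Summits.Ventures.PercRepro.RankLevelSetExplicitLin2KeyQuart

/-!
# PercRepro — THE QUART KEY ROW AT `(q, p) = (16, 153 192)`, PART B: chunks 5 … 8 of 16 (p9, S4)

`proofs/SUBCLAIM-S4-p9.md` §S4.2⁗‴. The quart key `KeyQ 16 153192 d` (RankLevelSetExplicitLin2KeyQuart) at the coranks
`16401 … 32784` of the level-16 row at `p = 153 192`, by the kernel (`decide`, four chunks of
4 096); the row is assembled in RankLevelSetExplicitLin2QuartRowSixteen. Axioms: standard.
-/

namespace PercRepro

namespace ThmN

namespace Explicit

/-- The quart key row at `(q, p) = (16, 153 192)`, chunk 5 of 16: coranks `16401 … 20496`, by the kernel. -/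
theorem key_sixteen_quart_row_5 : ∀ t < 4096, KeyQ 16 153192 (17 + (16384 + t)) := by decide +kernel

/-- The quart key row at `(q, p) = (16, 153 192)`, chunk 6 of 16: coranks `20497 … 24592`, by the kernel. -/
theorem key_sixteen_quart_row_6 : ∀ t < 4096, KeyQ 16 153192 (17 + (20480 + t)) := by decide +kernel

/-- The quart key row at `(q, p) = (16, 153 192)`, chunk 7 of 16: coranks `24593 … 28688`, by the kernel. -/
theorem key_sixteen_quart_row_7 : ∀ t < 4096, KeyQ 16 153192 (17 + (24576 + t)) := by decide +kernel

/-- The quart key row at `(q, p) = (16, 153 192)`, chunk 8 of 16: coranks `28689 … 32784`, by the kernel. -/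
theorem key_sixteen_quart_row_8 : ∀ t < 4096, KeyQ 16 153192 (17 + (28672 + t)) := by decide +kernel

end Explicit

end ThmN

end PercRepro
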